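import Mathlib
import Summits.ResolutionOfSingularities.ResolutionOfSingularities.Theorems.HomologicalConductorPersistenceSurfaceStepAddCover
import Summits.ResolutionOfSingularities.ResolutionOfSingularities.Theorems.HomologicalConductorPersistenceFaithfullyFlatAddDescent
import Summits.ResolutionOfSingularities.ResolutionOfSingularities.Theorems.HomologicalConductorPersistenceFaithfullyFlatDescentCompletion
import Summits.ResolutionOfSingularities.ResolutionOfSingularities.Theorems.HomologicalConductorNoZenoHighSyzygyDual
import Literature.RingTheory.CohomologyAnnihilator.SyzygyBaseChange
import HarnessLib

/-!
# Rung S-2 `PersistenceSurface` (stmt-ResolutionOfSingularities-19970) — w44b-o10b: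
# the step cover PRODUCED OVER A FAITHFULLY FLAT EXTENSION and descended

Route `ResolutionOfSingularities/HomologicalConductor`, chain W4.4b (cell res-hironaka; seat res-D-pv-043, named
reserve for o10). OURS; nothing here is a statement of the manuscript under review (Hironaka 2017); AI-written,
weaker than expert review.

o10a (`…PersistenceSurfaceStepAddCover`, p512214) reduced o8's interface `HasStepDualCover T T'` over an étale
sandwich `T → T₁`, `T' → T''` to MODULE data: third-syzygy `T₁`-modules `Y j` and, over `T''`, the `add`-closure
clause «every third syzygy lies in `add (T'' ⊕ ⊕ⱼ (T'' ⊗ Y j)*)`». In print that clause is produced over the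
COMPLETION (or henselisation) of the upper local ring — Krull–Schmidt, Wunram, Iyama–Wemyss live there — not over
the étale neighbourhood `T''` itself. o8c (`…PersistenceFaithfullyFlatAddDescent`, res-type-015) supplies the
descent of `add`-membership along a faithfully flat ring map for finitely presented modules. This file composes:

* `isRetractOfPower_of_faithfullyFlat_baseChange` — for `S` faithfully flat over noetherian `R` and finitely
  generated `R`-modules `G`, `L`: `S ⊗ L ∈ add (S ⊗ G)` over `S` ⇒ `L ∈ add G` over `R` (o8c (D4) in the tree's
  `IsRetractOfPower` vocabulary);
* `addCover_of_faithfullyFlat` — if every `n`-th syzygy over `S` lies in `add (S ⊗ G)` then every `n`-th syzygy over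
  `R` lies in `add G` (flat base change of syzygies, `IsSyzygy.baseChange`, then the above);
* `isRetractOfPower_baseChange_dualBlocks` — the standard generator base-changes to the `S`-native one:
  `S ⊗_R (R ⊕ ⊕ⱼ (D j)*) ≃ S ⊕ ⊕ⱼ (S ⊗_R D j)*` for finitely generated `D j` (duals of finitely presented modules
  commute with flat base change, o8c (D5) `isBaseChange_dualBaseChange`), so an `S`-native cover is a cover by
  `S ⊗_R G`;
* `hasStepDualCover_of_etaleSandwich_of_faithfullyFlat` — THE PACKAGE: étale sandwich + a faithfully flat
  `T''`-algebra `S` + third-syzygy `T₁`-modules `Y j` + the cover clause OVER `S`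
  «every third syzygy of a finitely generated `S`-module lies in `add (S ⊕ ⊕ⱼ (S ⊗_{T''} (T'' ⊗_{T₁} Y j))*)`»
  ⊢ `HasStepDualCover T T'`;
* `hasStepDualCover_of_etaleSandwich_of_completionCover` — the instance `S := T̂''` (faithfully flat by res-type-015's
  `faithfullyFlat_adicCompletion`): the cover clause may be supplied over the COMPLETE local ring `T̂''`.

So o10 proper = at a step INTO a singular (R♮) stage, choose `S` (model: `T̂''` — `S` is NOT assumed noetherian
here, so the completion qualifies as soon as its faithful flatness over `T''` is available) and discharge the
`S`-level clause from (IW)/(IW-p) + (E-sur) in W4.4's vocabulary — nothing else.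

References: S. B. Iyengar, R. Takahashi, *Annihilation of cohomology and strong generation of module
categories*, IMRN 2016, arXiv:1404.1476 [`IyengarTakahashi2014`]; descent along faithfully flat maps is
folklore (Stacks 0583, 03C4).
-/

set_option linter.dupNamespace false

noncomputable section

open CategoryTheory Literature.RingTheory.CohomologyAnnihilator
open Summit.ResolutionOfSingularities.ResolutionOfSingularities.Theorems.NoZeno.SandwichCluster
open Summit.ResolutionOfSingularities.ResolutionOfSingularities.Theorems.HomologicalConductor
open Summit.ResolutionOfSingularities.ResolutionOfSingularities.Theorems.HomologicalConductor.PersistenceSurfaceRationalAssembly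
open Summit.ResolutionOfSingularities.ResolutionOfSingularities.Theorems.HomologicalConductor.PersistenceSurfaceStepAddCover
open Summit.ResolutionOfSingularities.ResolutionOfSingularities.Theorems.HomologicalConductor.PersistenceFaithfullyFlatAddDescent
open scoped TensorProduct

namespace Summit.ResolutionOfSingularities.ResolutionOfSingularities.Theorems.HomologicalConductor.PersistenceSurfaceStepCoverDescent

universe u

/-! ## `add`-membership descends along faithfully flat maps (o8c (D4), categorical form) -/

/-- **`add`-membership descends (OURS · w44b-o10b; o8c (D4) repackaged).** `S` faithfully flat over the noetherian
ring `R`, `G` and `L` finitely generated `R`-modules: if `S ⊗_R L ∈ add (S ⊗_R G)` over `S` then `L ∈ add G` over `R`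
(`exists_retract_pow_of_retract_pow_baseChange`, p-o8c, in the `IsRetractOfPower` vocabulary of
[IyengarTakahashi2014, Def. 4.1]). [cite: IyengarTakahashi2014, Definition 4.1] -/
theorem isRetractOfPower_of_faithfullyFlat_baseChange {R : Type u} [CommRing R] (S : Type u) [CommRing S]
    [Algebra R S] [Module.FaithfullyFlat R S] [IsNoetherianRing R]
    (G : ModuleCat.{u} R) [Module.Finite R G] (L : ModuleCat.{u} R) [Module.Finite R L]
    (h : IsRetractOfPower (ModuleCat.of S (S ⊗[R] G)) (ModuleCat.of S (S ⊗[R] L))) :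
    IsRetractOfPower G L := by
  haveI : Module.FinitePresentation R G := Module.finitePresentation_of_finite R G
  haveI : Module.FinitePresentation R L := Module.finitePresentation_of_finite R L
  obtain ⟨a, i, p, hip⟩ := h
  have hip' : p.hom ∘ₗ i.hom = LinearMap.id := by
    have h1 := congrArg ModuleCat.Hom.hom hip
    rw [ModuleCat.hom_comp, ModuleCat.hom_id] at h1
    exact h1
  obtain ⟨n, i', r', h'⟩ :=
    exists_retract_pow_of_retract_pow_baseChange S (L := L) (N := G) a ⟨i.hom, p.hom, hip'⟩
  refine ⟨n, ModuleCat.ofHom i', ModuleCat.ofHom r', ?_⟩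
  apply ModuleCat.hom_ext
  rw [ModuleCat.hom_comp, ModuleCat.hom_ofHom, ModuleCat.hom_ofHom, ModuleCat.hom_id]
  exact h'

/-- **A cover of syzygies over `S` descends to `R` (OURS · w44b-o10b).** `S` faithfully flat over noetherian `R`,
`G` a finitely generated `R`-module: if every `n`-th syzygy of a finitely generated `S`-module lies in
`add (S ⊗_R G)`, then every `n`-th syzygy of a finitely generated `R`-module lies in `add G` — base-change the
syzygy (`IsSyzygy.baseChange`, flat) and descend (`isRetractOfPower_of_faithfullyFlat_baseChange`).
[cite: IyengarTakahashi2014, Theorem 5.4 (proof)] -/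
theorem addCover_of_faithfullyFlat {R : Type u} [CommRing R] (S : Type u) [CommRing S] [Algebra R S]
    [Module.FaithfullyFlat R S] [IsNoetherianRing R] (n : ℕ) (G : ModuleCat.{u} R) [Module.Finite R G]
    (hS : ∀ (M' L' : ModuleCat.{u} S), Module.Finite S M' → IsSyzygy n M' L' →
      IsRetractOfPower (ModuleCat.of S (S ⊗[R] G)) L')
    (M L : ModuleCat.{u} R) (hM : Module.Finite R M) (hL : IsSyzygy n M L) : IsRetractOfPower G L := by
  haveI := hM
  haveI : Module.Finite R L := finite_of_isSyzygy n hM hL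
  have hL' : IsSyzygy n (ModuleCat.of S (S ⊗[R] M)) (ModuleCat.of S (S ⊗[R] L)) :=
    IsSyzygy.baseChange S n hL
  exact isRetractOfPower_of_faithfullyFlat_baseChange S G L
    (hS _ _ (Module.Finite.base_change R S M) hL')

/-! ## The standard generator under base change -/

/-- **Base change of the dual-block generator (OURS · w44b-o10b).** For `S` flat over the noetherian ring `R` and
finitely generated `R`-modules `D j`: the `S`-native generator `S ⊕ ⊕ⱼ (S ⊗_R D j)*` lies in
`add (S ⊗_R (R ⊕ ⊕ⱼ (D j)*))` — indeed the two are isomorphic: `⊗` distributes over finite products, `S ⊗_R R ≅ S`,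
and `S ⊗_R (D j)* ≅ (S ⊗_R D j)*` by o8c (D5) (`isBaseChange_dualBaseChange`: duals of finitely presented modules
commute with flat base change). Hence every `S`-native cover is a cover by the base-changed generator. (At a tower
step, `D j := T'' ⊗_{T₁} Y j`.) [folklore] -/
theorem isRetractOfPower_baseChange_dualBlocks {R : Type u} [CommRing R] (S : Type u) [CommRing S] [Algebra R S]
    [Module.Flat R S] [IsNoetherianRing R] {ι : Type} [Fintype ι] (D : ι → Type u)
    [∀ j, AddCommGroup (D j)] [∀ j, Module R (D j)] [∀ j, Module.Finite R (D j)] {L' : ModuleCat.{u} S}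
    (h : IsRetractOfPower (ModuleCat.of S (S × (Π j, Module.Dual S (S ⊗[R] D j)))) L') :
    IsRetractOfPower (ModuleCat.of S (S ⊗[R] (R × (Π j, Module.Dual R (D j))))) L' := by
  classical
  haveI : ∀ j, Module.FinitePresentation R (D j) := fun j => Module.finitePresentation_of_finite R _
  -- the comparison isomorphism
  let eD : ∀ j, S ⊗[R] Module.Dual R (D j) ≃ₗ[S] Module.Dual S (S ⊗[R] D j) :=
    fun j => (isBaseChange_dualBaseChange S (D j)).equiv
  let e : S ⊗[R] (R × (Π j, Module.Dual R (D j))) ≃ₗ[S] (S × (Π j, Module.Dual S (S ⊗[R] D j))) :=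
    TensorProduct.prodRight R S S R (Π j, Module.Dual R (D j)) ≪≫ₗ
      LinearEquiv.prodCongr (TensorProduct.AlgebraTensorModule.rid R S S)
        (TensorProduct.piRight R S S (fun j => Module.Dual R (D j)) ≪≫ₗ LinearEquiv.piCongrRight eD)
  have hgen : IsRetractOfPower (ModuleCat.of S (S ⊗[R] (R × (Π j, Module.Dual R (D j)))))
      (ModuleCat.of S (S × (Π j, Module.Dual S (S ⊗[R] D j)))) :=
    (isRetractOfPower_self _).of_iso e.toModuleIso
  exact hgen.of_isRetractOfPower_gen h

/-! ## The package: étale sandwich + faithfully flat cover ring -/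

/-- **`HasStepDualCover` from a cover produced over a faithfully flat extension of the upper étale neighbourhood
(OURS · w44b-o10b).** Data: the étale sandwich of o10a (`T₁` a localisation of an étale `T`-algebra, `T''` a pointed
étale neighbourhood of the noetherian local ring `T'`, a `T₁`-algebra structure on `T''` with the square commuting
on `T`); a FAITHFULLY FLAT `T''`-algebra `S` (NOT assumed noetherian; model: the completion `T̂''`, where
Krull–Schmidt and the McKay/Wunram/Iyama–Wemyss theory live); finitely many third-syzygy `T₁`-modules `Y j`; and
the cover clause OVER `S`: every third syzygy of a finitely generated `S`-module lies in
`add (S ⊕ ⊕ⱼ (S ⊗_{T''} (T'' ⊗_{T₁} Y j))*)` (blocks written over `T''` so that no `T₁`-algebra structure on `S` is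
needed; `S ⊗_{T''} (T'' ⊗_{T₁} Y) ≅ S ⊗_{T₁} Y` canonically). Then `HasStepDualCover T T'`: the clause descends to
`T''` with generator
`G := T'' ⊕ ⊕ⱼ (T'' ⊗_{T₁} Y j)*` (`addCover_of_faithfullyFlat` + `isRetractOfPower_baseChange_dualBlocks`), and
o10a's `hasStepDualCover_of_etaleSandwich` concludes with `hG := isRetractOfPower_self`.
[cite: IyengarTakahashi2014, Definition 4.1] -/
theorem hasStepDualCover_of_etaleSandwich_of_faithfullyFlat
    {T T' : Type} [CommRing T] [CommRing T'] [Algebra T T'] [IsNoetherianRing T] [IsNoetherianRing T']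
    [IsLocalRing T']
    (E T₁ : Type) [CommRing E] [CommRing T₁] [Algebra T E] [Algebra E T₁] [Algebra T T₁]
    [IsScalarTower T E T₁] [Algebra.Etale T E] (U : Submonoid E) [IsLocalization U T₁]
    (E' T'' : Type) [CommRing E'] [CommRing T''] [Algebra T' E'] [Algebra E' T''] [Algebra T' T'']
    [IsScalarTower T' E' T''] [Algebra.Etale T' E'] (𝔮 : Ideal E') [𝔮.IsPrime]
    [IsLocalization.AtPrime T'' 𝔮] (h𝔮 : 𝔮.under T' = IsLocalRing.maximalIdeal T')
    [Algebra T₁ T'']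
    (hsq : ∀ t : T, algebraMap T₁ T'' (algebraMap T T₁ t) = algebraMap T' T'' (algebraMap T T' t))
    (S : Type) [CommRing S] [Algebra T'' S] [Module.FaithfullyFlat T'' S]
    {ι : Type} [Fintype ι] (Y : ι → ModuleCat.{0} T₁)
    (hY : ∀ j, ∃ M : ModuleCat.{0} T₁, Module.Finite T₁ M ∧ IsSyzygy 3 M (Y j))
    (hcoverS : ∀ (M' L' : ModuleCat.{0} S), Module.Finite S M' → IsSyzygy 3 M' L' →
      IsRetractOfPower (ModuleCat.of S (S × (Π j, Module.Dual S (S ⊗[T''] (T'' ⊗[T₁] Y j))))) L') :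
    HasStepDualCover T T' := by
  classical
  haveI : IsNoetherianRing E := Algebra.FiniteType.isNoetherianRing T E
  haveI : IsNoetherianRing T₁ := IsLocalization.isNoetherianRing U T₁ inferInstance
  haveI : IsNoetherianRing E' := Algebra.FiniteType.isNoetherianRing T' E'
  haveI : IsNoetherianRing T'' := IsLocalization.isNoetherianRing 𝔮.primeCompl T'' inferInstance
  haveI : ∀ j, Module.Finite T₁ (Y j) := fun j => by
    obtain ⟨M, hM, hMY⟩ := hY j
    exact finite_of_isSyzygy 3 hM hMY
  haveI : ∀ j, Module.Finite T'' (Module.Dual T'' (T'' ⊗[T₁] (Y j : Type))) := fun j =>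
    finite_dual (T := T'') _
  let G : ModuleCat.{0} T'' := ModuleCat.of T'' (T'' × (Π j, Module.Dual T'' (T'' ⊗[T₁] Y j)))
  haveI : Module.Finite T'' G := by
    change Module.Finite T'' (T'' × (Π j, Module.Dual T'' (T'' ⊗[T₁] Y j)))
    infer_instance
  have hIW : ∀ (M L : ModuleCat.{0} T''), Module.Finite T'' M → IsSyzygy 3 M L → IsRetractOfPower G L :=
    addCover_of_faithfullyFlat S 3 G fun M' L' hM' hL' =>
      isRetractOfPower_baseChange_dualBlocks (R := T'') S (fun j => T'' ⊗[T₁] (Y j : Type))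
        (hcoverS M' L' hM' hL')
  exact hasStepDualCover_of_etaleSandwich E T₁ U E' T'' 𝔮 h𝔮 hsq Y hY G (isRetractOfPower_self _) hIW

/-- **`HasStepDualCover` from a cover over the COMPLETION of the upper étale neighbourhood (OURS · w44b-o10b).**
The instance `S := T̂''` (`AdicCompletion 𝔪 T''`) of `hasStepDualCover_of_etaleSandwich_of_faithfullyFlat`: the
pointed étale neighbourhood `T'' = E'_𝔮` of `T'` is a noetherian local ring, so `T'' → T̂''` is faithfully flat
(res-type-015's `faithfullyFlat_adicCompletion`). Hence `HasStepDualCover T T'` follows from third-syzygy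
`T₁`-modules `Y j` and the cover clause over the COMPLETE local ring `T̂''` — the printed setting of Krull–Schmidt /
Wunram / Iyama–Wemyss — «every third syzygy of a finitely generated `T̂''`-module lies in
`add (T̂'' ⊕ ⊕ⱼ (T̂'' ⊗_{T''} (T'' ⊗_{T₁} Y j))*)`». No noetherianity of `T̂''` is used.
[cite: IyengarTakahashi2014, Definition 4.1] -/
theorem hasStepDualCover_of_etaleSandwich_of_completionCover
    {T T' : Type} [CommRing T] [CommRing T'] [Algebra T T'] [IsNoetherianRing T] [IsNoetherianRing T']
    [IsLocalRing T']
    (E T₁ : Type) [CommRing E] [CommRing T₁] [Algebra T E] [Algebra E T₁] [Algebra T T₁]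
    [IsScalarTower T E T₁] [Algebra.Etale T E] (U : Submonoid E) [IsLocalization U T₁]
    (E' T'' : Type) [CommRing E'] [CommRing T''] [Algebra T' E'] [Algebra E' T''] [Algebra T' T'']
    [IsScalarTower T' E' T''] [Algebra.Etale T' E'] (𝔮 : Ideal E') [𝔮.IsPrime]
    [IsLocalization.AtPrime T'' 𝔮] (h𝔮 : 𝔮.under T' = IsLocalRing.maximalIdeal T')
    [Algebra T₁ T''] [IsLocalRing T'']
    (hsq : ∀ t : T, algebraMap T₁ T'' (algebraMap T T₁ t) = algebraMap T' T'' (algebraMap T T' t))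
    {ι : Type} [Fintype ι] (Y : ι → ModuleCat.{0} T₁)
    (hY : ∀ j, ∃ M : ModuleCat.{0} T₁, Module.Finite T₁ M ∧ IsSyzygy 3 M (Y j))
    (hcover : ∀ (M' L' : ModuleCat.{0} (AdicCompletion (IsLocalRing.maximalIdeal T'') T'')),
      Module.Finite (AdicCompletion (IsLocalRing.maximalIdeal T'') T'') M' → IsSyzygy 3 M' L' →
        IsRetractOfPower (ModuleCat.of (AdicCompletion (IsLocalRing.maximalIdeal T'') T'')
          ((AdicCompletion (IsLocalRing.maximalIdeal T'') T'') ×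
            (Π j, Module.Dual (AdicCompletion (IsLocalRing.maximalIdeal T'') T'')
              ((AdicCompletion (IsLocalRing.maximalIdeal T'') T'') ⊗[T''] (T'' ⊗[T₁] Y j))))) L') :
    HasStepDualCover T T' := by
  haveI : IsNoetherianRing E' := Algebra.FiniteType.isNoetherianRing T' E'
  haveI : IsNoetherianRing T'' := IsLocalization.isNoetherianRing 𝔮.primeCompl T'' inferInstance
  haveI : Module.FaithfullyFlat T'' (AdicCompletion (IsLocalRing.maximalIdeal T'') T'') :=
    PersistenceFaithfullyFlatDescentCompletion.faithfullyFlat_adicCompletion T''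
  exact hasStepDualCover_of_etaleSandwich_of_faithfullyFlat E T₁ U E' T'' 𝔮 h𝔮 hsq
    (AdicCompletion (IsLocalRing.maximalIdeal T'') T'') Y hY hcover

end Summit.ResolutionOfSingularities.ResolutionOfSingularities.Theorems.HomologicalConductor.PersistenceSurfaceStepCoverDescent

end
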